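import Summits.AnomalousDissipation.AnomalousDissipation.Theorems.GalerkinSteadyZerothLaw.Negative.LoadBearing
import Summits.AnomalousDissipation.AnomalousDissipation.Theorems.LaminarNeverLoud.Negative.StokesArc

/-!
# Negative knowledge for the crux `GalerkinSteadyZerothLaw` (stmt-AnomalousDissipation-2986, route MirrorVariety):
# II, the coefficient → field bridge, the Stokes states, and the load-bearing obligations

Certified copy of §3 of the cdisprove work file `Cruxes/GalerkinSteadyZerothLaw/Disproof.lean`
(refuter-cdisprove-stmt-AnomalousDissipation-2986-0, cycle 1). Supports stmt-AnomalousDissipation-2986; nothing here asserts a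
Theses decl positively (the `crux_true_…` theorems assert WEAKENINGS of the crux with one conjunct of its conclusion deleted).

* `fieldOf`, `steadyState_fieldOf` — every zero `c ∈ galerkinSubspace S_N` of `galerkinRHS S_N ν ĝ` (Fourier vector `ĝ` of an
  `L²` force) is an admissible tested-form steady state of the crux (the last clause of `exists_steady_galerkin_approx` run on a
  GIVEN zero); `integral_norm_sq_fieldOf`, `loudness_fieldOf` (Parseval: energy and `ν‖∇·‖²` are the coefficient ones).
* `stokesField m a ν N` — the Stokes state of the shear force `2a cos(2π m x₁)e₀` (landed `LaminarNeverLoud.Negative.StokesArc`)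
  as a field: `steadyState_stokesField`, `integral_norm_sq_stokesField` (`2(a/4π²νm²)²`), `loudness_stokesField` (`a²/2π²νm²`),
  `loudness_eq_on_stokesField` (the injection ceiling `ν‖∇U‖² ≤ ‖f‖₂‖U‖₂` of file I is ATTAINED at every single viscosity).
* LOAD-BEARING OBLIGATIONS: `crux_true_without_energy_bound`, `crux_true_without_vanishing_viscosity`,
  `crux_true_with_moving_energy` — delete the energy bound, or `ν_j → 0`, or the uniformity of `E` in `j`, and the statement is
  TRUE by the gravest Stokes states. The content of the crux is exactly the conjunction of the three.
-/

noncomputable section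

open scoped InnerProductSpace Topology ComplexConjugate
open MeasureTheory Filter UnitAddTorus
open Literature.Analysis.FunctionSpaces Literature.Analysis.FunctionSpaces.Torus
open Literature.Analysis.FluidPDE

namespace Summit.AnomalousDissipation.AnomalousDissipation.Theorems.GalerkinSteadyZerothLaw.Negative

open Summit.AnomalousDissipation.AnomalousDissipation.Theses.MirrorVariety (GalerkinSteadyZerothLaw)
variable {d : Type*} [Fintype d] [DecidableEq d]

/-! ## §3 Load-bearing obligations, witnessed by the Stokes states of a shear force

For an `∃`-statement the load-bearing analysis asks which CONJUNCTS OF THE CONCLUSION cannot be deleted without making the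
statement trivially true. The witnesses are the explicit laminar Stokes states `U = f/(4π²νm²)` of the shear force
`f = 2a cos(2π m x₁) e₀` (landed at the coefficient level in `Theorems/LaminarNeverLoud/Negative/StokesArc.lean`), turned into
tested-form fields by the coefficient → field bridge below (the converse bookkeeping of `exists_steady_galerkin_approx`). -/

open Summit.AnomalousDissipation.AnomalousDissipation.Theorems.LaminarNeverLoud.Negative

/-- The real field of a coefficient vector on the punctured ball of radius `N`. -/
def fieldOf (N : ℕ) (c : ↥(modes d N) → EuclideanSpace ℂ d) : UnitAddTorus d → EuclideanSpace ℝ d :=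
  realTrigPoly (modes d N) (coeffExt (modes d N) c)

/-- **Coefficient → field bridge.** Every zero `c ∈ galerkinSubspace S_N` of the stationary Galerkin field
`galerkinRHS S_N ν ĝ` driven by the Fourier vector `ĝ` of an `L²` force `f` yields an admissible tested-form steady state
`fieldOf N c` of the crux at `(ν, N)` for the force `f` (verbatim the last clause of `exists_steady_galerkin_approx`, run on a
GIVEN zero instead of the Brouwer one). This is how coefficient-level witnesses (continuation numerics, explicit arcs) enter
the crux. [folklore] -/
theorem steadyState_fieldOf {ν : ℝ} {N : ℕ} {f : UnitAddTorus d → EuclideanSpace ℝ d} (hf : MemLp f 2 volume)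
    {c : ↥(modes d N) → EuclideanSpace ℂ d} (hc : c ∈ galerkinSubspace (modes d N))
    (h0 : galerkinRHS (modes d N) ν (forceCoeff (modes d N) f) c = 0) :
    SteadyState ν N f (fieldOf N c) := by
  have hS : ∀ k ∈ modes d N, -k ∈ modes d N := modes_symm N
  have hS0 : (0 : d → ℤ) ∉ modes d N := zero_not_mem_modes N
  have hfi : Integrable f volume := hf.integrable one_le_two
  have hgr : IsRealCoeff (forceCoeff (modes d N) f) := isRealCoeff_forceCoeff (modes d N) hfi
  have hCsymm : IsConjSymm (coeffExt (modes d N) c) := hc.1.isConjSymm_coeffExt hS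
  have hCT : IsTransversal (modes d N) (coeffExt (modes d N) c) := hc.2.isTransversal_coeffExt
  have hGg : realTrigPoly (modes d N) (coeffExt (modes d N) (forceCoeff (modes d N) f)) =
      realTrigPoly (modes d N) fun k => mFourierCoeff (EuclideanSpace.complexify ∘ f) k :=
    realTrigPoly_coeffExt_restrict _
  refine ⟨isSmooth_realTrigPoly _ _, isDivFree_realTrigPoly hCT, hasZeroMean_realTrigPoly_of_zero_not_mem hS0 _,
    fun k hk => mFourierCoeff_realTrigPoly_eq_zero hS hCsymm hk, ?_⟩
  intro a ha hdiv hband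
  have hid := Literature.Analysis.FluidPDE.Torus.sum_re_inner_galerkinField_test ν hS (hgr.isConjSymm_coeffExt hS) hCsymm hCT ha hdiv hband
  have hzero : ∑ k ∈ modes d N, (inner ℂ (Literature.Analysis.FluidPDE.Torus.galerkinField ν (modes d N) (coeffExt (modes d N) (forceCoeff (modes d N) f))
      (coeffExt (modes d N) c) k) (mFourierCoeff (EuclideanSpace.complexify ∘ a) k)).re = 0 := by
    refine Finset.sum_eq_zero fun k hk => ?_
    have hk0 : Literature.Analysis.FluidPDE.Torus.galerkinField ν (modes d N) (coeffExt (modes d N) (forceCoeff (modes d N) f))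
        (coeffExt (modes d N) c) k = 0 := by
      have := congrFun h0 ⟨k, hk⟩
      rwa [galerkinRHS_apply] at this
    rw [hk0, inner_zero_left, Complex.zero_re]
  rw [hzero, hGg] at hid
  have hu : IsSmooth (fieldOf N c) := isSmooth_realTrigPoly _ _
  have hGs : IsSmooth (realTrigPoly (modes d N) fun k => mFourierCoeff (EuclideanSpace.complexify ∘ f) k) :=
    isSmooth_realTrigPoly _ _
  have i1 : Integrable (fun x => ⟪fieldOf N c x, convect (fieldOf N c) a x⟫_ℝ +
      ν * ⟪fieldOf N c x, laplacian a x⟫_ℝ) volume :=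
    ((hu.continuous.inner (hu.convect ha).continuous).add
      ((hu.continuous.inner ha.laplacian.continuous).const_smul ν)).integrable_unitAddTorus
  have i2 : Integrable (fun x => ⟪realTrigPoly (modes d N)
      (fun k => mFourierCoeff (EuclideanSpace.complexify ∘ f) k) x, a x⟫_ℝ) volume :=
    (hGs.continuous.inner ha.continuous).integrable_unitAddTorus
  have i3 : Integrable (fun x => ⟪f x, a x⟫_ℝ) volume := integrable_inner_of_continuous hfi ha.continuous
  have hforce := integral_inner_realTrigPoly_mFourierCoeff_eq hS hf
    (ha.continuous.memLp_of_hasCompactSupport (HasCompactSupport.of_compactSpace _)) hband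
  unfold fieldOf at i1 ⊢
  rw [integral_add i1 i2, hforce, ← integral_add i1 i3] at hid
  exact hid.symm

/-- Parseval: the energy of `fieldOf N c` is the coefficient energy `∑‖c k‖²`. [folklore] -/
theorem integral_norm_sq_fieldOf {N : ℕ} {c : ↥(modes d N) → EuclideanSpace ℂ d}
    (hc : c ∈ galerkinSubspace (modes d N)) : ∫ x, ‖fieldOf N c x‖ ^ 2 = energy c := by
  rw [fieldOf, integral_norm_sq_realTrigPoly (modes_symm N) (hc.1.isConjSymm_coeffExt (modes_symm N)),
    sum_coeffExt (fun _ v => ‖v‖ ^ 2) c]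
  rfl

/-- Parseval: `ν‖∇(fieldOf N c)‖²` is the coefficient dissipation `ν·4π²∑|k|²‖c k‖²`. [folklore] -/
theorem loudness_fieldOf {N : ℕ} (ν : ℝ) {c : ↥(modes d N) → EuclideanSpace ℂ d}
    (hc : c ∈ galerkinSubspace (modes d N)) : ν * gradNormSq (fieldOf N c) = dissipation ν c := by
  rw [fieldOf, gradNormSq_eq_toReal_eGradNormSq_holds (isSmooth_realTrigPoly _ _),
    toReal_eGradNormSq_realTrigPoly (modes_symm N) (hc.1.isConjSymm_coeffExt (modes_symm N)),
    sum_coeffExt (fun k v => freqNormSq k * ‖v‖ ^ 2) c]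
  rfl

/-- The Stokes state of the shear force `2a cos(2π m x₁) e₀` at viscosity `ν`, as a field band-limited to resolution `N`
(`= 2(a/(4π²νm²)) cos(2π m x₁) e₀` when `N ≥ |m|`). -/
def stokesField (m : ℤ) (a ν : ℝ) (N : ℕ) : UnitAddTorus (Fin 3) → EuclideanSpace ℝ (Fin 3) :=
  fieldOf N (shearVec (modes (Fin 3) N) m (a / (4 * Real.pi ^ 2 * ν * (m : ℝ) ^ 2)))

variable {m : ℤ}

/-- **The Stokes states are admissible steady states of the crux** (tested form), at every resolution `N ≥ |m|` and every
`ν ≠ 0`. [folklore] -/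
theorem steadyState_stokesField (hm : m ≠ 0) (a : ℝ) {ν : ℝ} (hν : ν ≠ 0) {N : ℕ} (hN : m.natAbs ≤ N) :
    SteadyState ν N (shearForce m a) (stokesField m a ν N) := by
  have h0 := galerkinRHS_stokesPoint (kol_mem_modes hm hN) (neg_kol_mem_modes hm hN) hm a hν
  rw [← forceCoeff_shearForce] at h0
  exact steadyState_fieldOf ((isSmooth_shearForce m a).memLp 2) (shearVec_mem m _) h0

/-- Energy of the Stokes state: `∫|U|² = 2(a/(4π²νm²))²`. [folklore] -/
theorem integral_norm_sq_stokesField (hm : m ≠ 0) (a ν : ℝ) {N : ℕ} (hN : m.natAbs ≤ N) :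
    ∫ x, ‖stokesField m a ν N x‖ ^ 2 = 2 * (a / (4 * Real.pi ^ 2 * ν * (m : ℝ) ^ 2)) ^ 2 := by
  rw [stokesField, integral_norm_sq_fieldOf (shearVec_mem m _)]
  exact energy_stokesPoint (kol_mem_modes hm hN) (neg_kol_mem_modes hm hN) hm a ν

/-- Loudness of the Stokes state: `ν‖∇U‖² = a²/(2π²νm²)`. [folklore] -/
theorem loudness_stokesField (hm : m ≠ 0) (a : ℝ) {ν : ℝ} (hν : ν ≠ 0) {N : ℕ} (hN : m.natAbs ≤ N) :
    ν * gradNormSq (stokesField m a ν N) = a ^ 2 / (2 * Real.pi ^ 2 * ν * (m : ℝ) ^ 2) := by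
  rw [stokesField, loudness_fieldOf ν (shearVec_mem m _)]
  exact dissipation_stokesPoint_eq (kol_mem_modes hm hN) (neg_kol_mem_modes hm hN) hm a hν

/-- `∫‖2a cos(2π m x₁)e₀‖² = 2a²`. [folklore] -/
theorem integral_norm_sq_shearForce (hm : m ≠ 0) (a : ℝ) : ∫ x, ‖shearForce m a x‖ ^ 2 = 2 * a ^ 2 := by
  rw [shearForce, integral_norm_sq_realTrigPoly (shearModes_symm m) (isConjSymm_shearCoeff m a), shearModes,
    Finset.sum_pair (kol_ne_neg hm), shearCoeff_of_shear a (Or.inl rfl), shearCoeff_of_shear a (Or.inr rfl),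
    norm_smul_e0_sq]
  ring

/-- **TIGHTNESS of the injection ceiling `loudness_le`**: on the Stokes state, `ν‖∇U‖² = ‖f‖₂‖U‖₂` (equality in
Cauchy–Schwarz: `U ∥ f`). So at each SINGLE viscosity the budget window `ε² ≤ E∫‖f‖²` of §2 cannot be improved; what the
Stokes states cannot do is keep `E` bounded as `ν → 0` (`integral_norm_sq_stokesField ∼ ν⁻²`). [folklore] -/
theorem loudness_eq_on_stokesField (hm : m ≠ 0) (a : ℝ) {ν : ℝ} (hν : 0 < ν) {N : ℕ} (hN : m.natAbs ≤ N) :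
    ν * gradNormSq (stokesField m a ν N) =
      Real.sqrt (∫ x, ‖shearForce m a x‖ ^ 2) * Real.sqrt (∫ x, ‖stokesField m a ν N x‖ ^ 2) := by
  have hm' : (m : ℝ) ≠ 0 := Int.cast_ne_zero.2 hm
  rw [loudness_stokesField hm a hν.ne' hN, integral_norm_sq_shearForce hm a, integral_norm_sq_stokesField hm a ν hN,
    ← Real.sqrt_mul (by positivity)]
  symm
  rw [Real.sqrt_eq_iff_mul_self_eq (by positivity) (by positivity)]
  field_simp
  ring

/-- The gravest shear force `2cos(2πx₁)e₀` is an admissible force of the crux. [folklore] -/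
theorem shearForce_admissible : IsSmooth (shearForce 1 1) ∧ IsDivFree (shearForce 1 1) ∧ HasZeroMean (shearForce 1 1) :=
  ⟨isSmooth_shearForce 1 1, isDivFree_shearForce 1 1, hasZeroMean_shearForce one_ne_zero 1⟩

/-- Loudness of the gravest Stokes state in closed form: `ν‖∇U‖² = 1/(2π²ν)`. [folklore] -/
theorem loudness_stokesField_one {ν : ℝ} (hν : ν ≠ 0) {N : ℕ} (hN : 1 ≤ N) :
    ν * gradNormSq (stokesField 1 1 ν N) = 1 / (2 * Real.pi ^ 2 * ν) := by
  rw [loudness_stokesField one_ne_zero 1 hν hN]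
  push_cast
  ring

/-- Energy of the gravest Stokes state in closed form: `∫|U|² = 2/(4π²ν)²`. [folklore] -/
theorem integral_norm_sq_stokesField_one (ν : ℝ) {N : ℕ} (hN : 1 ≤ N) :
    ∫ x, ‖stokesField 1 1 ν N x‖ ^ 2 = 2 * (1 / (4 * Real.pi ^ 2 * ν)) ^ 2 := by
  rw [integral_norm_sq_stokesField one_ne_zero 1 ν hN]
  push_cast
  ring

/-- **THE ENERGY BOUND IS LOAD-BEARING**: with the clause `∫|U|² ≤ E` deleted the crux is TRUE — the Stokes states of the
gravest shear force along `ν_j = 1/(j+1)` are loud (`ν_j‖∇U‖² = (j+1)/(2π²) ≥ 1/(2π²)`) at every resolution `N ≥ 1`, while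
their energy `2(j+1)²/(16π⁴)` runs away. (The laminar runaway of the route's card, as a theorem about the statement.)
[folklore] -/
theorem crux_true_without_energy_bound :
    ∃ f : UnitAddTorus (Fin 3) → EuclideanSpace ℝ (Fin 3), IsSmooth f ∧ IsDivFree f ∧ HasZeroMean f ∧
      ∃ (ν : ℕ → ℝ) (ε : ℝ), (∀ j, 0 < ν j) ∧ Tendsto ν atTop (𝓝 0) ∧ 0 < ε ∧
        ∀ j, ∃ᶠ N in atTop, ∃ U : UnitAddTorus (Fin 3) → EuclideanSpace ℝ (Fin 3),
          SteadyState (ν j) N f U ∧ ε ≤ ν j * gradNormSq U := by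
  refine ⟨shearForce 1 1, shearForce_admissible.1, shearForce_admissible.2.1, shearForce_admissible.2.2,
    fun j => 1 / ((j : ℝ) + 1), 1 / (2 * Real.pi ^ 2), fun j => by positivity,
    tendsto_one_div_add_atTop_nhds_zero_nat, by positivity, fun j => ?_⟩
  refine Filter.Eventually.frequently ((eventually_ge_atTop 1).mono fun N hN => ?_)
  have hν : 1 / ((j : ℝ) + 1) ≠ 0 := by positivity
  refine ⟨stokesField 1 1 (1 / ((j : ℝ) + 1)) N, steadyState_stokesField one_ne_zero 1 hν hN, ?_⟩
  rw [loudness_stokesField_one hν hN]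
  have hj : (0 : ℝ) ≤ j := Nat.cast_nonneg j
  have hπ : 0 < 2 * Real.pi ^ 2 := by positivity
  have h1 : 1 / ((j : ℝ) + 1) ≤ 1 := by rw [div_le_one (by positivity)]; linarith
  rw [div_le_div_iff₀ hπ (by positivity), one_mul, one_mul]
  exact mul_le_of_le_one_right hπ.le h1

/-- **`ν_j → 0` IS LOAD-BEARING**: with `Tendsto ν atTop (𝓝 0)` deleted the crux is TRUE — constant viscosity `ν_j = 1` and
the gravest Stokes state, loud `1/(2π²)` and bounded `2/(16π⁴)`, at every resolution `N ≥ 1`. [folklore] -/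
theorem crux_true_without_vanishing_viscosity :
    ∃ f : UnitAddTorus (Fin 3) → EuclideanSpace ℝ (Fin 3), IsSmooth f ∧ IsDivFree f ∧ HasZeroMean f ∧
      ∃ (ν : ℕ → ℝ) (E ε : ℝ), (∀ j, 0 < ν j) ∧ 0 < ε ∧ FrequentlyLoud f ν E ε := by
  refine ⟨shearForce 1 1, shearForce_admissible.1, shearForce_admissible.2.1, shearForce_admissible.2.2,
    fun _ => 1, 2 * (1 / (4 * Real.pi ^ 2 * 1)) ^ 2, 1 / (2 * Real.pi ^ 2 * 1), fun _ => one_pos, by positivity,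
    fun j => ?_⟩
  refine Filter.Eventually.frequently ((eventually_ge_atTop 1).mono fun N hN => ?_)
  exact ⟨stokesField 1 1 1 N, steadyState_stokesField one_ne_zero 1 one_ne_zero hN,
    (integral_norm_sq_stokesField_one 1 hN).le, (loudness_stokesField_one one_ne_zero hN).ge⟩

/-- **UNIFORMITY OF `E` IN `j` IS LOAD-BEARING**: with a `j`-dependent energy budget (`∀ j, ∃ E, …`) the crux is TRUE
along `ν_j = 1/(j+1) → 0` — the gravest Stokes states again, `E_j = 2((j+1)/(4π²))²`. [folklore] -/
theorem crux_true_with_moving_energy :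
    ∃ f : UnitAddTorus (Fin 3) → EuclideanSpace ℝ (Fin 3), IsSmooth f ∧ IsDivFree f ∧ HasZeroMean f ∧
      ∃ (ν : ℕ → ℝ) (ε : ℝ), (∀ j, 0 < ν j) ∧ Tendsto ν atTop (𝓝 0) ∧ 0 < ε ∧
        ∀ j, ∃ E : ℝ, ∃ᶠ N in atTop, ∃ U : UnitAddTorus (Fin 3) → EuclideanSpace ℝ (Fin 3),
          SteadyState (ν j) N f U ∧ ∫ x, ‖U x‖ ^ 2 ≤ E ∧ ε ≤ ν j * gradNormSq U := by
  refine ⟨shearForce 1 1, shearForce_admissible.1, shearForce_admissible.2.1, shearForce_admissible.2.2,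
    fun j => 1 / ((j : ℝ) + 1), 1 / (2 * Real.pi ^ 2), fun j => by positivity,
    tendsto_one_div_add_atTop_nhds_zero_nat, by positivity, fun j => ⟨2 * (1 / (4 * Real.pi ^ 2 * (1 / ((j : ℝ) + 1)))) ^ 2, ?_⟩⟩
  refine Filter.Eventually.frequently ((eventually_ge_atTop 1).mono fun N hN => ?_)
  have hν : 1 / ((j : ℝ) + 1) ≠ 0 := by positivity
  refine ⟨stokesField 1 1 (1 / ((j : ℝ) + 1)) N, steadyState_stokesField one_ne_zero 1 hν hN,
    (integral_norm_sq_stokesField_one _ hN).le, ?_⟩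
  rw [loudness_stokesField_one hν hN]
  have hj : (0 : ℝ) ≤ j := Nat.cast_nonneg j
  have hπ : 0 < 2 * Real.pi ^ 2 := by positivity
  have h1 : 1 / ((j : ℝ) + 1) ≤ 1 := by rw [div_le_one (by positivity)]; linarith
  rw [div_le_div_iff₀ hπ (by positivity), one_mul, one_mul]
  exact mul_le_of_le_one_right hπ.le h1

end Summit.AnomalousDissipation.AnomalousDissipation.Theorems.GalerkinSteadyZerothLaw.Negative

end
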